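import Summits.CriticalPhenomena.CardyFormulaZ2.Theorems.CardyIKTransportIKLinearTransportSDECore5

/-!
# Stub `stub_StripDiagramExchange` — core part 6: independence, parities, and the mixing estimate

Continues `…SDECore5`. On the core space: determined events are measurable; events determined by disjoint sets of
bits are independent (`SDE.P_inter_det`, from `iIndepFun_infinitePi`); the parity law `P(even) - P(odd) = (1-2w)^n`;
and THE MIXING ESTIMATE `|8 P(E ∩ Per_N) - P(E)| ≤ (1 - 2q)^{N - 2M}` for events `E` read in the window
`[-M, M]` (periodicity = equal seam row bits ∧ even plaquette parities; the outside parities are independent of the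
window, exactly fair on the honeycomb column and exponentially close to fair on the isotropic one).
-/

set_option autoImplicit false

noncomputable section

namespace Summit.CriticalPhenomena.CardyFormulaZ2.Theorems.IKLinearTransport.PinnedDiagramExchange

open scoped Classical MeasureTheory ENNReal ProbabilityTheory BigOperators
open MeasureTheory Literature.Probability.Percolation Literature.Probability.LatticeModels

namespace SDE

/-! ## §15 Probability toolkit on the core space: locality, independence, parities -/

/-- Determined events are preimages under the restriction to their coordinates. [folklore] -/
theorem det_eq_preimage (J : Finset Idx) {E : Set K} (hE : E ∈ DetSets J) :
    E = (fun (b : K) (j : ↥J) => b j) ⁻¹' ((fun (b : K) (j : ↥J) => b j) '' E) := by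
  ext b
  constructor
  · intro hb; exact ⟨b, hb, rfl⟩
  · rintro ⟨b', hb', he⟩
    exact (hE b' b fun j hj => congrFun he ⟨j, hj⟩).1 hb'

/-- Determined events are measurable. [folklore] -/
theorem measurableSet_of_det (J : Finset Idx) {E : Set K} (hE : E ∈ DetSets J) : MeasurableSet E := by
  rw [det_eq_preimage J hE]
  exact (Set.toFinite ((fun (b : K) (j : ↥J) => b j) '' E)).measurableSet.preimage
    (measurable_pi_lambda _ fun j => measurable_pi_apply (j : Idx))

/-- Monotonicity of determination. [folklore] -/
theorem det_mono {J J' : Finset Idx} (h : J ⊆ J') {E : Set K} (hE : E ∈ DetSets J) : E ∈ DetSets J' :=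
  fun b b' hb => hE b b' fun j hj => hb j (h hj)

/-- Determined events form an algebra. [folklore] -/
theorem det_inter {J : Finset Idx} {E E' : Set K} (hE : E ∈ DetSets J) (hE' : E' ∈ DetSets J) : E ∩ E' ∈ DetSets J :=
  fun b b' hb => by rw [Set.mem_inter_iff, Set.mem_inter_iff, hE b b' hb, hE' b b' hb]

/-- Complements of determined events. [folklore] -/
theorem det_compl {J : Finset Idx} {E : Set K} (hE : E ∈ DetSets J) : Eᶜ ∈ DetSets J :=
  fun b b' hb => by rw [Set.mem_compl_iff, Set.mem_compl_iff, hE b b' hb]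

/-- A coordinate event is determined by that coordinate. [folklore] -/
theorem det_coord (j : Idx) (t : Bool) : {b : K | b j = t} ∈ DetSets {j} :=
  fun b b' hb => by rw [Set.mem_setOf_eq, Set.mem_setOf_eq, hb j (Finset.mem_singleton_self j)]

/-- INDEPENDENCE of events determined by disjoint sets of bits. [folklore] -/
theorem P_inter_det {S T : Finset Idx} (hST : Disjoint S T) {A B : Set K} (hA : A ∈ DetSets S) (hB : B ∈ DetSets T) :
    P (A ∩ B) = P A * P B := by
  have hind : ProbabilityTheory.iIndepFun (fun (j : Idx) (b : K) => b j) P := by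
    unfold P
    exact ProbabilityTheory.iIndepFun_infinitePi (P := fun j : Idx => (Ber(true, false, wt j.1) : Measure Bool))
      (X := fun _ x => x) (fun _ => measurable_id)
  have h2 := hind.indepFun_finset S T hST (fun j => measurable_pi_apply j)
  rw [det_eq_preimage S hA, det_eq_preimage T hB]
  exact h2.measure_inter_preimage_eq_mul _ _ (Set.toFinite ((fun (b : K) (j : ↥S) => b j) '' A)).measurableSet
    (Set.toFinite ((fun (b : K) (j : ↥T) => b j) '' B)).measurableSet

/-- The same in real numbers. [folklore] -/
theorem Preal_inter_det {S T : Finset Idx} (hST : Disjoint S T) {A B : Set K} (hA : A ∈ DetSets S) (hB : B ∈ DetSets T) :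
    P.real (A ∩ B) = P.real A * P.real B := by
  rw [measureReal_def, P_inter_det hST hA hB, ENNReal.toReal_mul, measureReal_def, measureReal_def]

/-- Single-bit probabilities. [folklore] -/
theorem Preal_coord (j : Idx) (t : Bool) : P.real {b : K | b j = t} = if t then (wt j.1 : ℝ) else 1 - wt j.1 := by
  have hset : {b : K | b j = t} = Set.pi ↑({j} : Finset Idx) (fun j' => {(fun _ => t : Idx → Bool) j'}) := by
    rw [Finset.coe_singleton, Set.singleton_pi']; rfl
  rw [measureReal_def, hset, P_pi, Finset.prod_singleton, ENNReal.toReal_ofReal]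
  split_ifs
  · exact (wt j.1).2.1
  · exact sub_nonneg.2 (wt j.1).2.2

/-- Finite-set parity of a bit sequence. [folklore] -/
def bparF (F : Finset ℤ) (f : ℤ → Bool) : Bool := decide ((∑ s ∈ F, bz (f s)) = 1)

/-- `bp` is a parity over an interval. [folklore] -/
theorem bp_eq_bparF (f : ℤ → Bool) (u v : ℤ) : bp f u v = bparF (Finset.Ico (min u v) (max u v)) f := rfl

/-- Parity of a disjoint union. [folklore] -/
theorem bparF_union {F G : Finset ℤ} (h : Disjoint F G) (f : ℤ → Bool) : bparF (F ∪ G) f = (bparF F f ^^ bparF G f) := by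
  have fin : ∀ a b : ZMod 2, decide (a + b = 1) = (decide (a = 1) ^^ decide (b = 1)) := by decide
  unfold bparF; rw [Finset.sum_union h, fin]

/-- Parity with one more point. [folklore] -/
theorem bparF_insert {F : Finset ℤ} {y : ℤ} (h : y ∉ F) (f : ℤ → Bool) : bparF (insert y F) f = (f y ^^ bparF F f) := by
  have fin : ∀ (t : Bool) (b : ZMod 2), decide (bz t + b = 1) = (t ^^ decide (b = 1)) := by decide
  unfold bparF; rw [Finset.sum_insert h, fin]

/-- Parity events are determined by their bits. [folklore] -/
theorem det_bparF (k : Fin 5) (F : Finset ℤ) (t : Bool) :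
    {b : K | bparF F (fun s => b (k, s)) = t} ∈ DetSets (({k} : Finset (Fin 5)) ×ˢ F) := by
  intro b b' hb
  have e : bparF F (fun s => b (k, s)) = bparF F (fun s => b' (k, s)) := by
    have hs : ∑ s ∈ F, bz (b (k, s)) = ∑ s ∈ F, bz (b' (k, s)) := Finset.sum_congr rfl fun s hs => by
      rw [hb (k, s) (Finset.mem_product.2 ⟨Finset.mem_singleton_self k, hs⟩)]
    unfold bparF
    simp only [hs]
  rw [Set.mem_setOf_eq, Set.mem_setOf_eq, e]

/-- THE PARITY LAW: `P(even) - P(odd) = (1 - 2w)^{#bits}` for the parity of independent Bernoulli(`w`) bits. [folklore] -/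
theorem parity_law (k : Fin 5) (F : Finset ℤ) :
    P.real {b : K | bparF F (fun s => b (k, s)) = false} - P.real {b : K | bparF F (fun s => b (k, s)) = true} =
      (1 - 2 * (wt k : ℝ)) ^ F.card := by
  induction F using Finset.induction_on with
  | empty =>
    have h0 : ∀ b : K, bparF ∅ (fun s => b (k, s)) = false := fun b => by unfold bparF; simp
    simp only [h0, Finset.card_empty, pow_zero, Set.setOf_true, probReal_univ, Bool.false_eq_true, Set.setOf_false,
      measureReal_empty, sub_zero]
  | insert y F hy ih =>
    have hsplit : ∀ t : Bool, {b : K | bparF (insert y F) (fun s => b (k, s)) = t} =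
        ({b : K | b (k, y) = false} ∩ {b | bparF F (fun s => b (k, s)) = t}) ∪
          ({b : K | b (k, y) = true} ∩ {b | bparF F (fun s => b (k, s)) = !t}) := fun t => by
      ext b
      simp only [Set.mem_setOf_eq, bparF_insert hy, Set.mem_union, Set.mem_inter_iff]
      cases b (k, y) <;> cases bparF F (fun s => b (k, s)) <;> cases t <;> simp
    have hdisj : ∀ t : Bool, Disjoint ({b : K | b (k, y) = false} ∩ {b | bparF F (fun s => b (k, s)) = t})
        ({b : K | b (k, y) = true} ∩ {b | bparF F (fun s => b (k, s)) = !t}) := fun t => by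
      rw [Set.disjoint_left]
      rintro b ⟨h1, -⟩ ⟨h2, -⟩
      rw [Set.mem_setOf_eq] at h1 h2
      rw [h1] at h2; exact Bool.false_ne_true h2
    have hmeas : ∀ t t' : Bool, MeasurableSet ({b : K | b (k, y) = t'} ∩ {b | bparF F (fun s => b (k, s)) = t}) :=
      fun t t' => (measurableSet_of_det _ (det_coord (k, y) t')).inter (measurableSet_of_det _ (det_bparF k F t))
    have hdj : Disjoint ({(k, y)} : Finset Idx) (({k} : Finset (Fin 5)) ×ˢ F) := by
      rw [Finset.disjoint_singleton_left]; simp [hy]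
    have hprod : ∀ t t' : Bool, P.real ({b : K | b (k, y) = t'} ∩ {b | bparF F (fun s => b (k, s)) = t}) =
        (if t' then (wt k : ℝ) else 1 - wt k) * P.real {b | bparF F (fun s => b (k, s)) = t} := fun t t' => by
      rw [Preal_inter_det hdj (det_coord (k, y) t') (det_bparF k F t), Preal_coord]
    rw [hsplit false, hsplit true, measureReal_union (hdisj false) (hmeas _ _), measureReal_union (hdisj true) (hmeas _ _),
      hprod, hprod, hprod, hprod, Finset.card_insert_of_notMem hy, pow_succ, ← ih]
    simp only [Bool.not_false, Bool.not_true, if_true, Bool.false_eq_true, if_false]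
    ring

/-- Consequence: the two parity probabilities. [folklore] -/
theorem parity_prob (k : Fin 5) (F : Finset ℤ) (t : Bool) :
    P.real {b : K | bparF F (fun s => b (k, s)) = t} =
      (1 + (if t then -1 else 1) * (1 - 2 * (wt k : ℝ)) ^ F.card) / 2 := by
  have hdisj : Disjoint {b : K | bparF F (fun s => b (k, s)) = false} {b : K | bparF F (fun s => b (k, s)) = true} :=
    Set.disjoint_left.2 fun b h1 h2 => by
      rw [Set.mem_setOf_eq] at h1 h2; rw [h1] at h2; exact Bool.false_ne_true h2
  have hunion : {b : K | bparF F (fun s => b (k, s)) = false} ∪ {b : K | bparF F (fun s => b (k, s)) = true} = Set.univ :=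
    Set.eq_univ_of_forall fun b => by cases h : bparF F (fun s => b (k, s)) <;> simp [h]
  have hsum : P.real {b : K | bparF F (fun s => b (k, s)) = false} +
      P.real {b : K | bparF F (fun s => b (k, s)) = true} = 1 := by
    rw [← measureReal_union hdisj (measurableSet_of_det _ (det_bparF k F true)), hunion, probReal_univ]
  have hdiff := parity_law k F
  cases t
  · simp only [Bool.false_eq_true, if_false, one_mul]; linarith
  · simp only [if_true, neg_one_mul]; linarith


/-- Splitting a probability along a Boolean statistic. [folklore] -/
theorem Preal_split (C : Set K) (hC : MeasurableSet C) (T : K → Bool) (hT : ∀ t, MeasurableSet {b | T b = t}) :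
    P.real C = P.real (C ∩ {b | T b = false}) + P.real (C ∩ {b | T b = true}) := by
  rw [← measureReal_union (Set.disjoint_left.2 fun b h1 h2 => by
      have e1 : T b = false := h1.2; have e2 : T b = true := h2.2; rw [e1] at e2; exact Bool.false_ne_true e2) (hC.inter (hT true))]
  congr 1
  ext b
  simp only [Set.mem_union, Set.mem_inter_iff, Set.mem_setOf_eq]
  cases T b <;> simp

/-! ## §16 Mixing: periodicity is asymptotically independent of the window -/

/-- The faces of the cylinder window outside the fixed window `[-M, M)`. [folklore] -/
def Out (M N : ℕ) : Finset ℤ := Finset.Ico (aN N) (aN N + N) \ Finset.Ico (-(M : ℤ)) M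

/-- Size of `Out`. [folklore] -/
theorem Out_card (M N : ℕ) (hN : 2 * M + 4 ≤ N) : (Out M N).card = N - 2 * M := by
  obtain ⟨ha1, ha2, -, -⟩ := aN_bounds N M hN
  have hsub : Finset.Ico (-(M : ℤ)) M ⊆ Finset.Ico (aN N) (aN N + N) := fun y hy => by
    rw [Finset.mem_Ico] at hy ⊢; omega
  rw [Out, Finset.card_sdiff_of_subset hsub, Int.card_Ico, Int.card_Ico]
  omega

/-- The seam parity splits into the window parity and the outside parity. [folklore] -/
theorem bp_seam_split (M N : ℕ) (hN : 2 * M + 4 ≤ N) (f : ℤ → Bool) :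
    bp f (aN N) (aN N + N) = (bparF (Finset.Ico (-(M : ℤ)) M) f ^^ bparF (Out M N) f) := by
  obtain ⟨ha1, ha2, -, -⟩ := aN_bounds N M hN
  have hsub : Finset.Ico (-(M : ℤ)) M ⊆ Finset.Ico (aN N) (aN N + N) := fun y hy => by
    rw [Finset.mem_Ico] at hy ⊢; omega
  rw [bp_eq_bparF, min_eq_left (by omega), max_eq_right (by omega), Out, ← bparF_union Finset.disjoint_sdiff,
    Finset.union_sdiff_of_subset hsub]

/-- The window bits and the seam/outside bits are disjoint. [folklore] -/
theorem Jw_disjoint_seam (M N : ℕ) (hN : 2 * M + 4 ≤ N) :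
    Disjoint (Jw (-(M : ℤ)) M) (({((0 : Fin 5), aN N), ((0 : Fin 5), aN N + N)} : Finset Idx) ∪
      ((({1} : Finset (Fin 5)) ×ˢ Out M N) ∪ (({3} : Finset (Fin 5)) ×ˢ Out M N))) := by
  obtain ⟨ha1, ha2, -, -⟩ := aN_bounds N M hN
  rw [Finset.disjoint_left]
  rintro ⟨k, y⟩ h1 h2
  rw [mem_Jw] at h1
  simp only [Finset.mem_union, Finset.mem_insert, Finset.mem_singleton, Prod.mk.injEq, Finset.mem_product, Out,
    Finset.mem_sdiff, Finset.mem_Ico] at h2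
  rcases h1 with ⟨rfl, hy⟩ | ⟨rfl, rfl⟩ | ⟨hk, hy⟩
  · rcases h2 with (⟨-, h⟩ | ⟨-, h⟩) | (⟨h, -⟩ | ⟨h, -⟩)
    · omega
    · omega
    · exact absurd h (by decide)
    · exact absurd h (by decide)
  · rcases h2 with (⟨h, -⟩ | ⟨h, -⟩) | (⟨h, -⟩ | ⟨h, -⟩) <;> exact absurd h (by decide)
  · rcases h2 with (⟨h, -⟩ | ⟨h, -⟩) | (⟨-, h⟩ | ⟨-, h⟩)
    · rw [h] at hk; exact absurd hk (by decide)
    · rw [h] at hk; exact absurd hk (by decide)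
    · omega
    · omega

/-- THE MIXING ESTIMATE: for an event `E` read in the window `[-M, M]`,
`|8 P(E ∩ Per_N) - P(E)| ≤ (1 - 2q)^{N - 2M}`. [folklore] -/
theorem mixing (M : ℕ) {E : Set K} (hE : E ∈ DetSets (Jw (-(M : ℤ)) M)) (N : ℕ) (hN : 2 * M + 4 ≤ N) :
    |8 * P.real (E ∩ Per (aN N) N) - P.real E| ≤ (1 - 2 * (qI : ℝ)) ^ (N - 2 * M) := by
  obtain ⟨ha1, ha2, -, -⟩ := aN_bounds N M hN
  -- the statistics
  let πin : Fin 5 → K → Bool := fun k b => bparF (Finset.Ico (-(M : ℤ)) M) (fun s => b (k, s))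
  let Z : Fin 5 → K → Bool := fun k b => bparF (Out M N) (fun s => b (k, s))
  let R : Set K := {b | b (0, aN N + N) = b (0, aN N)}
  let A : Bool → Bool → Set K := fun z₁ z₃ => E ∩ {b | πin 1 b = z₁} ∩ {b | πin 3 b = z₃}
  let B : Bool → Bool → Set K := fun z₁ z₃ => R ∩ {b | Z 1 b = z₁} ∩ {b | Z 3 b = z₃}
  -- determination
  have hπ : ∀ k : Fin 5, (k = 1 ∨ k = 2 ∨ k = 3) → ∀ t, {b | πin k b = t} ∈ DetSets (Jw (-(M : ℤ)) M) := fun k hk t =>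
    det_mono (fun j hj => by
      obtain ⟨k', y⟩ := j
      simp only [Finset.mem_product, Finset.mem_singleton, Finset.mem_Ico] at hj
      exact (mem_Jw _ _ k' y).2 (Or.inr (Or.inr ⟨by rw [hj.1]; exact hk, hj.2.1, hj.2.2⟩))) (det_bparF k _ t)
  have hA : ∀ z₁ z₃, A z₁ z₃ ∈ DetSets (Jw (-(M : ℤ)) M) := fun z₁ z₃ =>
    det_inter (det_inter hE (hπ 1 (Or.inl rfl) z₁)) (hπ 3 (Or.inr (Or.inr rfl)) z₃)
  have hRdet : R ∈ DetSets ({((0 : Fin 5), aN N), ((0 : Fin 5), aN N + N)} : Finset Idx) := fun b b' hb => by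
    simp only [R, Set.mem_setOf_eq]
    rw [hb _ (by simp), hb (0, aN N) (by simp)]
  have hZ : ∀ (k : Fin 5) t, {b | Z k b = t} ∈ DetSets (({k} : Finset (Fin 5)) ×ˢ Out M N) := fun k t => det_bparF k _ t
  have hB : ∀ z₁ z₃, B z₁ z₃ ∈ DetSets (({((0 : Fin 5), aN N), ((0 : Fin 5), aN N + N)} : Finset Idx) ∪
      ((({1} : Finset (Fin 5)) ×ˢ Out M N) ∪ (({3} : Finset (Fin 5)) ×ˢ Out M N))) := fun z₁ z₃ =>
    det_inter (det_inter (det_mono Finset.subset_union_left hRdet)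
      (det_mono (Finset.subset_union_left.trans Finset.subset_union_right) (hZ 1 z₁)))
      (det_mono (Finset.subset_union_right.trans Finset.subset_union_right) (hZ 3 z₃))
  -- the decomposition of `E ∩ Per`
  have hpiece : ∀ z₁ z₃, E ∩ Per (aN N) N ∩ {b | Z 1 b = z₁} ∩ {b | Z 3 b = z₃} = A z₁ z₃ ∩ B z₁ z₃ := fun z₁ z₃ => by
    ext b
    simp only [Set.mem_inter_iff, Set.mem_setOf_eq, Per, bp_seam_split M N hN, A, B, R]
    constructor
    · rintro ⟨⟨⟨hE, hr, h1, h3⟩, hz1⟩, hz3⟩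
      refine ⟨⟨⟨hE, ?_⟩, ?_⟩, ⟨hr, hz1⟩, hz3⟩
      · change (πin 1 b ^^ Z 1 b) = false at h1; rw [hz1] at h1; revert h1; cases πin 1 b <;> cases z₁ <;> decide
      · change (πin 3 b ^^ Z 3 b) = false at h3; rw [hz3] at h3; revert h3; cases πin 3 b <;> cases z₃ <;> decide
    · rintro ⟨⟨⟨hE, h1⟩, h3⟩, ⟨hr, hz1⟩, hz3⟩
      refine ⟨⟨⟨hE, hr, ?_, ?_⟩, hz1⟩, hz3⟩
      · change (πin 1 b ^^ Z 1 b) = false; rw [h1, hz1]; cases z₁ <;> rfl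
      · change (πin 3 b ^^ Z 3 b) = false; rw [h3, hz3]; cases z₃ <;> rfl
  have hmeasZ : ∀ (k : Fin 5) t, MeasurableSet {b | Z k b = t} := fun k t => measurableSet_of_det _ (hZ k t)
  have hmeasπ : ∀ t t', MeasurableSet {b : K | πin 1 b = t} ∧ MeasurableSet {b : K | πin 3 b = t'} := fun t t' =>
    ⟨measurableSet_of_det _ (hπ 1 (Or.inl rfl) t), measurableSet_of_det _ (hπ 3 (Or.inr (Or.inr rfl)) t')⟩
  have hEm : MeasurableSet E := measurableSet_of_det _ hE
  have hPerm : MeasurableSet (E ∩ Per (aN N) N) := by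
    have : E ∩ Per (aN N) N = ⋃ z₁ : Bool, ⋃ z₃ : Bool, A z₁ z₃ ∩ B z₁ z₃ := by
      ext b; simp only [Set.mem_iUnion, ← hpiece, Set.mem_inter_iff, Set.mem_setOf_eq]
      exact ⟨fun h => ⟨_, _, ⟨h, rfl⟩, rfl⟩, fun ⟨_, _, ⟨h, _⟩, _⟩ => h⟩
    rw [this]
    exact MeasurableSet.iUnion fun z₁ => MeasurableSet.iUnion fun z₃ =>
      (measurableSet_of_det _ (hA z₁ z₃)).inter (measurableSet_of_det _ (hB z₁ z₃))
  -- probabilities of the pieces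
  have hprod : ∀ z₁ z₃, P.real (A z₁ z₃ ∩ B z₁ z₃) = P.real (A z₁ z₃) * P.real (B z₁ z₃) := fun z₁ z₃ =>
    Preal_inter_det (Jw_disjoint_seam M N hN) (hA z₁ z₃) (hB z₁ z₃)
  have hRprob : P.real R = 1 / 2 := by
    have hne : ((0 : Fin 5), aN N) ≠ ((0 : Fin 5), aN N + N) := by simp; omega
    have e : R = ({b : K | b (0, aN N) = false} ∩ {b | b (0, aN N + N) = false}) ∪
        ({b : K | b (0, aN N) = true} ∩ {b | b (0, aN N + N) = true}) := by
      ext b; simp only [R, Set.mem_setOf_eq, Set.mem_union, Set.mem_inter_iff]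
      cases b (0, aN N) <;> cases b (0, aN N + N) <;> simp
    rw [e, measureReal_union (Set.disjoint_left.2 fun b h1 h2 => by
        have e1 : b (0, aN N) = false := h1.1; have e2 : b (0, aN N) = true := h2.1; rw [e1] at e2; exact Bool.false_ne_true e2)
      ((measurableSet_of_det _ (det_coord _ _)).inter (measurableSet_of_det _ (det_coord _ _))),
      Preal_inter_det (Finset.disjoint_singleton.2 hne) (det_coord _ _) (det_coord _ _),
      Preal_inter_det (Finset.disjoint_singleton.2 hne) (det_coord _ _) (det_coord _ _),
      Preal_coord, Preal_coord, Preal_coord, Preal_coord]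
    simp only [wt, show ((0 : Fin 5)) ≠ 1 by decide, if_false, coe_half, Bool.false_eq_true, if_true]
    norm_num
  have hZ3 : ∀ z, P.real {b | Z 3 b = z} = 1 / 2 := fun z => by
    show P.real {b : K | bparF (Out M N) (fun s => b (3, s)) = z} = 1 / 2
    rw [parity_prob, Out_card M N hN]
    simp only [wt, show ((3 : Fin 5)) ≠ 1 by decide, if_false, coe_half]
    rw [show (1 - 2 * (1 / 2 : ℝ)) = 0 by norm_num, zero_pow (by omega)]
    cases z <;> simp
  have hZ1 : ∀ z, P.real {b | Z 1 b = z} = (1 + (if z then -1 else 1) * (1 - 2 * (qI : ℝ)) ^ (N - 2 * M)) / 2 := fun z => by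
    show P.real {b : K | bparF (Out M N) (fun s => b (1, s)) = z} = _
    rw [parity_prob, Out_card M N hN]
    simp only [wt, if_true]
  have hBprob : ∀ z₁ z₃, P.real (B z₁ z₃) = 1 / 2 * ((1 + (if z₁ then -1 else 1) * (1 - 2 * (qI : ℝ)) ^ (N - 2 * M)) / 2) * (1 / 2) :=
    fun z₁ z₃ => by
    have hd1 : Disjoint ({((0 : Fin 5), aN N), ((0 : Fin 5), aN N + N)} : Finset Idx) (({1} : Finset (Fin 5)) ×ˢ Out M N) := by
      rw [Finset.disjoint_left]; rintro ⟨k, y⟩ h1 h2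
      simp only [Finset.mem_insert, Finset.mem_singleton, Prod.mk.injEq] at h1
      simp only [Finset.mem_product, Finset.mem_singleton] at h2
      rcases h1 with ⟨h, -⟩ | ⟨h, -⟩ <;> rw [h] at h2 <;> exact absurd h2.1 (by decide)
    have hd2 : Disjoint (({((0 : Fin 5), aN N), ((0 : Fin 5), aN N + N)} : Finset Idx) ∪ (({1} : Finset (Fin 5)) ×ˢ Out M N))
        (({3} : Finset (Fin 5)) ×ˢ Out M N) := by
      rw [Finset.disjoint_left]; rintro ⟨k, y⟩ h1 h2
      simp only [Finset.mem_union, Finset.mem_insert, Finset.mem_singleton, Prod.mk.injEq, Finset.mem_product] at h1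
      simp only [Finset.mem_product, Finset.mem_singleton] at h2
      rcases h1 with (⟨h, -⟩ | ⟨h, -⟩) | ⟨h, -⟩ <;> rw [h] at h2 <;> exact absurd h2.1 (by decide)
    show P.real (R ∩ {b | Z 1 b = z₁} ∩ {b | Z 3 b = z₃}) = _
    rw [Preal_inter_det hd2 (det_inter (det_mono Finset.subset_union_left hRdet) (det_mono Finset.subset_union_right (hZ 1 z₁))) (hZ 3 z₃),
      Preal_inter_det hd1 hRdet (hZ 1 z₁), hRprob, hZ1, hZ3]
  -- assembling
  have hsumPer : P.real (E ∩ Per (aN N) N) = ∑ z₁ : Bool, ∑ z₃ : Bool, P.real (A z₁ z₃) * P.real (B z₁ z₃) := by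
    rw [Preal_split _ hPerm (Z 1) (hmeasZ 1), Preal_split _ (hPerm.inter (hmeasZ 1 _)) (Z 3) (hmeasZ 3),
      Preal_split _ (hPerm.inter (hmeasZ 1 _)) (Z 3) (hmeasZ 3), hpiece, hpiece, hpiece, hpiece, hprod, hprod, hprod, hprod]
    simp only [Fintype.sum_bool]; ring
  have hsumE : P.real E = ∑ z₁ : Bool, ∑ z₃ : Bool, P.real (A z₁ z₃) := by
    rw [Preal_split _ hEm (πin 1) (fun t => (hmeasπ t t).1), Preal_split _ (hEm.inter (hmeasπ _ false).1) (πin 3) (fun t => (hmeasπ t t).2),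
      Preal_split _ (hEm.inter (hmeasπ _ false).1) (πin 3) (fun t => (hmeasπ t t).2)]
    simp only [Fintype.sum_bool, A]; ring
  rw [hsumPer, hsumE]
  simp only [Fintype.sum_bool, hBprob, if_true, if_false, Bool.false_eq_true]
  have hε : 0 ≤ (1 - 2 * (qI : ℝ)) ^ (N - 2 * M) := pow_nonneg (by linarith [qI_val.2.2]) _
  have h1 : 0 ≤ P.real (A true true) := measureReal_nonneg
  have h2 : 0 ≤ P.real (A true false) := measureReal_nonneg
  have h3 : 0 ≤ P.real (A false true) := measureReal_nonneg
  have h4 : 0 ≤ P.real (A false false) := measureReal_nonneg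
  have hle : P.real E ≤ 1 := by rw [← probReal_univ (μ := P)]; exact measureReal_mono (Set.subset_univ _)
  rw [hsumE] at hle
  simp only [Fintype.sum_bool] at hle
  rw [abs_le]
  constructor <;> nlinarith


end SDE

/-- THE MIXING ESTIMATE (part 6 of `stub_StripDiagramExchange`). [folklore] -/
theorem stripDX_mixing : ∀ (M : ℕ) (E : Set SDE.K), E ∈ SDE.DetSets (SDE.Jw (-(M : ℤ)) M) → ∀ (N : ℕ), 2 * M + 4 ≤ N → |8 * SDE.P.real (E ∩ SDE.Per (SDE.aN N) N) - SDE.P.real E| ≤ (1 - 2 * (SDE.qI : ℝ)) ^ (N - 2 * M) :=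
  fun M _ hE N hN => SDE.mixing M hE N hN

end Summit.CriticalPhenomena.CardyFormulaZ2.Theorems.IKLinearTransport.PinnedDiagramExchange
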